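import Summits.BirchSwinnertonDyer.BirchSwinnertonDyer.Theorems.TwistFamilyManinDescentIsogenyTableFamilyEngineTwo
import Literature.NumberTheory.EllipticCurves.BurungaleSkinner2023.RationalThreeTorsionEngineProofs
import Literature.NumberTheory.DiophantineGeometry.ConductorMultiplicativeProofs
import HarnessLib

/-!
# Route `TwistFamilyManinDescent`, crux `IsogenyTableFamiliesManinOne` (stmt-BirchSwinnertonDyer-25137): the THREE
# families needing the exact dyadic exponent — `j = −5280³` (4489a1), `j = −17²·101³/2` and `j = −17·373³/2¹⁷` (the
# `X₀(17)` pair of conductor `2·5²·17²`), granted modularity and Cremona `≤ 5·10⁵`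

THEOREMS ONLY (`--supports` 25137). Each is ONE application of the dyadic family engine
`classAbsManinConstantEqOne_of_j_eq_of_disc_support_two` (`2⁶·∏ q² = 287296, 462400, 462400 < 5·10⁵`) to an explicit
integral base model semistable at `2` (`4489a1 = [0,0,1,−7370,243528]`, `Δ = −67³`, good at `2`; the two `14450`
curves `[1,0,1,−3041,64278]` (`Δ = −2·5³·17⁴`, `c₄ = 145945` odd) and `[1,1,0,−660,−7600]` (`Δ = −2¹⁷·5³·17²`,
`c₄ = 31705` odd), multiplicative at `2`), with the whole-family descent as the hypothesis `hT` (item 25136, landed as `twistFamilyDescent_proof`; a binder here so that no route file is imported).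
With `…IsogenyTableFamiliesCrude.lean` this makes TEN of the eleven table families; the last (`j = −640320³`,
`163²`, odd twists only — the item's `2⁶ ∤ N` clause) remains. BSD is not proved; Manin's conjecture is not proved.
-/

-- D-0017: single-problem summit, so `Summit.BirchSwinnertonDyer.BirchSwinnertonDyer.…` repeats a namespace BY DESIGN.
set_option linter.dupNamespace false
set_option autoImplicit false

noncomputable section

open scoped Classical

open WeierstrassCurve IsDedekindDomain Rat.HeightOneSpectrum
  Literature.NumberTheory.EllipticCurves Literature.NumberTheory.EllipticCurves.ModularForms

namespace Summit.BirchSwinnertonDyer.BirchSwinnertonDyer.Theorems.TwistFamilyManinDescent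

/-- The place of `ℤ` with generator `2` is `primesEquiv.symm 2`. [folklore] -/
private theorem eq_place_two {v : HeightOneSpectrum ℤ} (hv : natGenerator v = 2) :
    v = (primesEquiv (R := ℤ)).symm ⟨2, Nat.prime_two⟩ := by
  rw [Equiv.eq_symm_apply]
  exact Subtype.ext hv

/-- `f₂ ≤ 1` for an integral model with odd discriminant (good at `2`). [cite: SilvermanAEC2009, VII.5 Prop. 5.1(a)] -/
private theorem conductorExponent_two_le_one_of_odd_Δ (W₀ : WeierstrassCurve ℤ) [(W₀.baseChange ℚ).IsElliptic]
    (hΔ : ¬ (2 : ℤ) ∣ W₀.Δ) (v : HeightOneSpectrum ℤ) (hv : natGenerator v = 2) :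
    (W₀.baseChange ℚ).conductorExponent v ≤ 1 := by
  haveI : PerfectField (IsLocalRing.ResidueField (v.adicCompletionIntegers ℚ)) := PerfectField.ofFinite
  have hg : (W₀.baseChange ℚ).HasGoodReductionAt v :=
    Literature.NumberTheory.EllipticCurves.BurungaleSkinner2023.hasGoodReductionAt_baseChange_int_of_not_dvd W₀
      (by rw [hv]; exact_mod_cast hΔ)
  rw [((W₀.baseChange ℚ).conductorExponent_eq_zero_iff_holds v).mpr hg]
  exact Nat.zero_le _

/-- `f₂ = 1 ≤ 1` for an integral model with `2 ∣ Δ`, `2 ∤ c₄` (multiplicative at `2`).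
[cite: SilvermanAEC2009, VII.5 Prop. 5.1(b)] -/
private theorem conductorExponent_two_le_one_of_mult (W₀ : WeierstrassCurve ℤ) [(W₀.baseChange ℚ).IsElliptic]
    (hΔ : (2 : ℤ) ∣ W₀.Δ) (hc₄ : ¬ (2 : ℤ) ∣ W₀.c₄) (v : HeightOneSpectrum ℤ) (hv : natGenerator v = 2) :
    (W₀.baseChange ℚ).conductorExponent v ≤ 1 := by
  haveI : PerfectField (IsLocalRing.ResidueField (v.adicCompletionIntegers ℚ)) := PerfectField.ofFinite
  haveI := Fact.mk Nat.prime_two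
  have hm : (W₀.baseChange ℚ).HasMultiplicativeReductionAtPrime 2 :=
    Literature.NumberTheory.EllipticCurves.BurungaleSkinner2023.hasMultiplicativeReductionAtPrime_baseChange_int_of_dvd_of_not_dvd
      W₀ (by exact_mod_cast hΔ) (by exact_mod_cast hc₄)
  have hm' : (W₀.baseChange ℚ).HasMultiplicativeReductionAt v := by
    rw [eq_place_two hv]
    exact ((W₀.baseChange ℚ).hasMultiplicativeReductionAtPrime_iff_hasMultiplicativeReductionAt_holds
      ⟨2, Nat.prime_two⟩).mp hm
  rw [((W₀.baseChange ℚ).conductorExponent_eq_one_iff_holds v).mpr hm']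

/-- A prime dividing `-(2^a·5³·17^b)` (as an explicit integer) is `2`, `5` or `17`. [elementary] -/
private theorem prime_mem_of_dvd_two_five_seventeen {q : ℕ} (hq : q.Prime) {a b : ℕ}
    (h : (q : ℤ) ∣ -((2 : ℤ) ^ a * 5 ^ 3 * 17 ^ b)) : q = 2 ∨ q ∈ ({5, 17} : Finset ℕ) := by
  rw [dvd_neg] at h
  have hqZ : Prime (q : ℤ) := Nat.prime_iff_prime_int.mp hq
  simp only [Finset.mem_insert, Finset.mem_singleton]
  rcases hqZ.dvd_or_dvd h with h2 | h17
  · rcases hqZ.dvd_or_dvd h2 with h2 | h5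
    · left
      have : q ∣ 2 := by exact_mod_cast hqZ.dvd_of_dvd_pow h2
      exact (Nat.prime_dvd_prime_iff_eq hq Nat.prime_two).mp this
    · right; left
      have : q ∣ 5 := by exact_mod_cast hqZ.dvd_of_dvd_pow h5
      exact (Nat.prime_dvd_prime_iff_eq hq (by norm_num)).mp this
  · right; right
    have : q ∣ 17 := by exact_mod_cast hqZ.dvd_of_dvd_pow h17
    exact (Nat.prime_dvd_prime_iff_eq hq (by norm_num)).mp this

section Families

variable
  (hT : ∀ (E₀ : WeierstrassCurve ℚ) [E₀.IsElliptic] (A : ℕ),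
    (∀ (q : ℕ) [Fact q.Prime], q ≠ 2 → Rank1Residual.Addv E₀ q → q ∣ A) →
    ∀ d₀ d₁ : ℤ, d₀ ≠ 0 → d₁ ≠ 0 → IsCoprime d₁ (2 * A * d₀) →
    ClassAbsManinConstantEqOne (E₀.quadraticTwist ((d₀ : ℤ) : ℚ)) →
    ClassAbsManinConstantEqOne (E₀.quadraticTwist ((-d₀ : ℤ) : ℚ)) →
    ClassAbsManinConstantEqOne (E₀.quadraticTwist ((d₀ * d₁ : ℤ) : ℚ)))
include hT

/-- **`j = −5280³` (base 4489a1 `[0,0,1,−7370,243528]`, `Δ = −67³`, good at `2`; `2⁶·67² = 287296`).**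
[cite: CremonaAlgorithms1997, Table 1 (4489a1) and §3.8] [cite: BarriosEtAl2025, Thm. 5.1] -/
theorem classAbsManinConstantEqOne_of_j_eq_neg_147197952000
    (hnf : exists_isNewformOf) (hCre : cremona_abs_maninConstant_eq_one_of_level_le_500000)
    (W : WeierstrassCurve ℚ) [W.IsElliptic] (hj : W.j = -147197952000) : ClassAbsManinConstantEqOne W := by
  have hΔ : (⟨0, 0, 1, -7370, 243528⟩ : WeierstrassCurve ℤ).Δ = -((67 : ℤ) ^ 3) := by
    norm_num [WeierstrassCurve.Δ, WeierstrassCurve.b₂, WeierstrassCurve.b₄, WeierstrassCurve.b₆, WeierstrassCurve.b₈]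
  have hc₄ : (⟨0, 0, 1, -7370, 243528⟩ : WeierstrassCurve ℤ).c₄ = 353760 := by
    norm_num [WeierstrassCurve.c₄, WeierstrassCurve.b₂, WeierstrassCurve.b₄]
  haveI : ((⟨0, 0, 1, -7370, 243528⟩ : WeierstrassCurve ℤ).baseChange ℚ).IsElliptic :=
    ⟨by rw [WeierstrassCurve.baseChange, WeierstrassCurve.map_Δ, hΔ]; norm_num⟩
  have hjb : ((⟨0, 0, 1, -7370, 243528⟩ : WeierstrassCurve ℤ).baseChange ℚ).j = -147197952000 := by
    rw [WeierstrassCurve.j, Units.val_inv_eq_inv_val, WeierstrassCurve.coe_Δ', WeierstrassCurve.baseChange,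
      WeierstrassCurve.map_Δ, WeierstrassCurve.map_c₄, hΔ, hc₄]
    norm_num [eq_intCast]
  refine classAbsManinConstantEqOne_of_j_eq_of_disc_support_two hnf hCre hT
    ⟨0, 0, 1, -7370, 243528⟩ (by rw [hjb]; norm_num) (by rw [hjb]; norm_num)
    (conductorExponent_two_le_one_of_odd_Δ _ (by rw [hΔ]; norm_num)) {67} (by simp; norm_num) (by simp)
    (fun q hq h ↦ Or.inr ?_) (by simp) W (by rw [hjb, hj])
  rw [hΔ, dvd_neg] at h
  have h' : q ∣ 67 ^ 3 := by exact_mod_cast h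
  simp [(Nat.prime_dvd_prime_iff_eq hq (by norm_num)).mp (hq.dvd_of_dvd_pow h')]

/-- **`j = −17²·101³/2` (base `[1,0,1,−3041,64278]`, `Δ = −2·5³·17⁴`, `c₄ = 145945`, multiplicative at `2`;
conductor `14450`; `2⁶·5²·17² = 462400`).** [cite: CremonaAlgorithms1997, Table 1 (14450) and §3.8]
[cite: BarriosEtAl2025, Thm. 5.1] -/
theorem classAbsManinConstantEqOne_of_j_eq_neg_297756989_div_2
    (hnf : exists_isNewformOf) (hCre : cremona_abs_maninConstant_eq_one_of_level_le_500000)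
    (W : WeierstrassCurve ℚ) [W.IsElliptic] (hj : W.j = -297756989 / 2) : ClassAbsManinConstantEqOne W := by
  have hΔ : (⟨1, 0, 1, -3041, 64278⟩ : WeierstrassCurve ℤ).Δ = -((2 : ℤ) ^ 1 * 5 ^ 3 * 17 ^ 4) := by
    norm_num [WeierstrassCurve.Δ, WeierstrassCurve.b₂, WeierstrassCurve.b₄, WeierstrassCurve.b₆, WeierstrassCurve.b₈]
  have hc₄ : (⟨1, 0, 1, -3041, 64278⟩ : WeierstrassCurve ℤ).c₄ = 145945 := by
    norm_num [WeierstrassCurve.c₄, WeierstrassCurve.b₂, WeierstrassCurve.b₄]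
  haveI : ((⟨1, 0, 1, -3041, 64278⟩ : WeierstrassCurve ℤ).baseChange ℚ).IsElliptic :=
    ⟨by rw [WeierstrassCurve.baseChange, WeierstrassCurve.map_Δ, hΔ]; norm_num⟩
  have hjb : ((⟨1, 0, 1, -3041, 64278⟩ : WeierstrassCurve ℤ).baseChange ℚ).j = -297756989 / 2 := by
    rw [WeierstrassCurve.j, Units.val_inv_eq_inv_val, WeierstrassCurve.coe_Δ', WeierstrassCurve.baseChange,
      WeierstrassCurve.map_Δ, WeierstrassCurve.map_c₄, hΔ, hc₄]
    norm_num [eq_intCast]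
  exact classAbsManinConstantEqOne_of_j_eq_of_disc_support_two hnf hCre hT
    ⟨1, 0, 1, -3041, 64278⟩ (by rw [hjb]; norm_num) (by rw [hjb]; norm_num)
    (conductorExponent_two_le_one_of_mult _ (by rw [hΔ]; norm_num) (by rw [hc₄]; norm_num)) {5, 17}
    (by simp; norm_num) (by simp) (fun q hq h ↦ prime_mem_of_dvd_two_five_seventeen hq (hΔ ▸ h)) (by simp) W
    (by rw [hjb, hj])

/-- **`j = −17·373³/2¹⁷` (base `[1,1,0,−660,−7600]`, `Δ = −2¹⁷·5³·17²`, `c₄ = 31705`, multiplicative at `2`;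
conductor `14450`; `2⁶·5²·17² = 462400`).** [cite: CremonaAlgorithms1997, Table 1 (14450) and §3.8]
[cite: BarriosEtAl2025, Thm. 5.1] -/
theorem classAbsManinConstantEqOne_of_j_eq_neg_882216989_div_131072
    (hnf : exists_isNewformOf) (hCre : cremona_abs_maninConstant_eq_one_of_level_le_500000)
    (W : WeierstrassCurve ℚ) [W.IsElliptic] (hj : W.j = -882216989 / 131072) : ClassAbsManinConstantEqOne W := by
  have hΔ : (⟨1, 1, 0, -660, -7600⟩ : WeierstrassCurve ℤ).Δ = -((2 : ℤ) ^ 17 * 5 ^ 3 * 17 ^ 2) := by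
    norm_num [WeierstrassCurve.Δ, WeierstrassCurve.b₂, WeierstrassCurve.b₄, WeierstrassCurve.b₆, WeierstrassCurve.b₈]
  have hc₄ : (⟨1, 1, 0, -660, -7600⟩ : WeierstrassCurve ℤ).c₄ = 31705 := by
    norm_num [WeierstrassCurve.c₄, WeierstrassCurve.b₂, WeierstrassCurve.b₄]
  haveI : ((⟨1, 1, 0, -660, -7600⟩ : WeierstrassCurve ℤ).baseChange ℚ).IsElliptic :=
    ⟨by rw [WeierstrassCurve.baseChange, WeierstrassCurve.map_Δ, hΔ]; norm_num⟩
  have hjb : ((⟨1, 1, 0, -660, -7600⟩ : WeierstrassCurve ℤ).baseChange ℚ).j = -882216989 / 131072 := by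
    rw [WeierstrassCurve.j, Units.val_inv_eq_inv_val, WeierstrassCurve.coe_Δ', WeierstrassCurve.baseChange,
      WeierstrassCurve.map_Δ, WeierstrassCurve.map_c₄, hΔ, hc₄]
    norm_num [eq_intCast]
  exact classAbsManinConstantEqOne_of_j_eq_of_disc_support_two hnf hCre hT
    ⟨1, 1, 0, -660, -7600⟩ (by rw [hjb]; norm_num) (by rw [hjb]; norm_num)
    (conductorExponent_two_le_one_of_mult _ (by rw [hΔ]; norm_num) (by rw [hc₄]; norm_num)) {5, 17}
    (by simp; norm_num) (by simp) (fun q hq h ↦ prime_mem_of_dvd_two_five_seventeen hq (hΔ ▸ h)) (by simp) W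
    (by rw [hjb, hj])

end Families

end Summit.BirchSwinnertonDyer.BirchSwinnertonDyer.Theorems.TwistFamilyManinDescent

end
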